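import Literature.Topology.FourManifolds.RegularLevelFlowMap
import Literature.Topology.FourManifolds.RegularLevelMorseData
import Literature.Topology.FourManifolds.TrisectionsTubeModel
import HarnessLib

/-!
# Morse data of functions of a flow-invariant function and the Morse function ("flow rule")

Topic `Literature/Topology/FourManifolds`; step E1 of a Morse-theoretic construction of
Gay–Kirby's trisection for the fact seat
`provefact-Literature.Topology.FourManifolds.exists_isBalancedGKTrisection` (Gay–Kirby 2016,
Thm. 4 via §4, Lemma 14).  Everything in this file is **proved**; the only definition is the
explicit lift `flowLift` of a function on a regular level along the trajectories.

Setting (`RegularLevelFlowMap.lean`): a closed manifold `M` modelled on `ℝᵐ⁺¹`, a Morse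
function `f`, a smooth gradient-like field `ξ` with its global flow, and a regular level
`Y = f⁻¹(a)` (`Literature.Topology.FourManifolds.RegularLevel`).  The projection along
trajectories `π = levelProj` is smooth on the open set `{Hits a}` of points whose trajectory
meets `Y`.  For `φ : Y → ℝ` the **lift** `φ̄ = flowLift φ` (`= φ ∘ π` on `{Hits a}`) is smooth
there, constant on trajectories and restricts to `φ` on `Y`; the sector functions of the
construction are of the form `Ψ = Γ(φ̄, f)` for smooth `Γ` of two variables.  This file proves
the first-order half of the "flow rule":

* `flowLift_flow`, `flowLift_apply`, `contMDiffAt_flowLift`;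
* `hasDerivAt_flowLift_comp_flow` — `φ̄` is constant along the flow, so `dφ̄(ξ) = 0`;
* `isMCriticalPt_flowLift_iff` — `z` is critical for `φ̄` iff `π z` is critical for `φ`
  (criticality propagates along trajectories; on `Y` itself it is Lagrange's condition of
  `RegularLevelMorseData.lean` closed up by `dφ̄(ξ) = 0 < df(ξ)`);
* `isMCriticalPt_comp₂_iff` — **`z` is critical for `Γ(φ̄, f)` iff `∂₂Γ = 0` and
  (`∂₁Γ = 0` or `π z` is critical for `φ`)**, and the regularity corollaries used to show that
  the sector functions have no critical points outside the fibres over the critical points of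
  the Heegaard function.

## References

* J. Milnor, *Lectures on the h-cobordism theorem* (1965), Thm. 3.4, proof of Thm. 5.4
  Assertion 4 (projection along trajectories). [MilnorHCobordism1965]
* J. Milnor, *Morse theory* (1963), §2–§3. [Milnor1963]
* D. Gay, R. Kirby, *Trisecting 4-manifolds*, Geom. Topol. 20 (2016), §4, Lemma 14. [GayKirby2016]
-/

open scoped Manifold ContDiff Topology
open Set Function Filter

noncomputable section

universe u

namespace Literature.Topology.FourManifolds

open Flow

/-- Local notation: `𝔼 n` is the model Euclidean space `EuclideanSpace ℝ (Fin n)`. -/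
local notation "𝔼 " n:arg => EuclideanSpace ℝ (Fin n)

/-! ### Smooth maps into a slice submanifold -/

namespace SliceChartFamily

variable {n : ℕ} {H : Type*} [TopologicalSpace H] {I : ModelWithCorners ℝ (𝔼 (n + 1)) H}
  {M : Type u} [TopologicalSpace M] [ChartedSpace H M] [IsManifold I ∞ M]
  {S : Set M} (Ψ : SliceChartFamily I S)
  {EN : Type*} [NormedAddCommGroup EN] [NormedSpace ℝ EN] {HN : Type*} [TopologicalSpace HN]
  {IN : ModelWithCorners ℝ EN HN} {N : Type*} [TopologicalSpace N] [ChartedSpace HN N]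

omit [IsManifold I ∞ M] in
/-- **A smooth map into `M` with values in the slice submanifold `S` is smooth as a map into
`S`** (for the structure `Ψ.chartedSpace`): in the level chart at the image point it reads
`(first n coordinates) ∘ (slice chart) ∘ g`. [cite: LeeSmoothManifolds2013, Thm. 5.8, Cor. 5.30] -/
theorem contMDiffAt_mk {g : N → M} {x : N} (hg : ContMDiffAt IN I ∞ g x) (hgS : ∀ x, g x ∈ S) :
    letI := Ψ.chartedSpace
    ContMDiffAt IN (𝓡 n) ∞ (fun x => (⟨g x, hgS x⟩ : S)) x := by
  letI := Ψ.chartedSpace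
  haveI := Ψ.isManifold
  set p : S := ⟨g x, hgS x⟩ with hp
  rw [contMDiffAt_iff_target]
  refine ⟨Topology.IsInducing.subtypeVal.continuousAt_iff.2 (by exact hg.continuousAt), ?_⟩
  -- the written map
  have hfun : (extChartAt (𝓡 n) (⟨g x, hgS x⟩ : S)) ∘ (fun x => (⟨g x, hgS x⟩ : S)) =
      fun x' => ((snocEquiv n).symm (I (Ψ.chart p (g x')))).1 := by
    funext x'
    simp only [comp_apply, extChartAt, OpenPartialHomeomorph.extend_coe, Ψ.chartAt_eq,
      modelWithCornersSelf_coe, id_eq]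
    rfl
  rw [hfun]
  have h1 : ContMDiffAt IN I ∞ (Ψ.chart p ∘ g) x :=
    ((contMDiffOn_of_mem_maximalAtlas (Ψ.mem_maximalAtlas p)).contMDiffAt
      ((Ψ.chart p).open_source.mem_nhds (Ψ.mem_source p))).comp x hg
  have h2 : ContMDiffAt IN 𝓘(ℝ, 𝔼 (n + 1)) ∞ (fun x' => I (Ψ.chart p (g x'))) x :=
    I.contMDiff.contMDiffAt.comp x h1
  have h3 : ContMDiff 𝓘(ℝ, 𝔼 (n + 1)) 𝓘(ℝ, 𝔼 n) ∞ fun y : 𝔼 (n + 1) => ((snocEquiv n).symm y).1 :=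
    (contDiff_snocEquiv_symm_fst (n := n)).contMDiff
  exact h3.contMDiffAt.comp x h2

end SliceChartFamily

/-! ### The lift of a function on a regular level along the trajectories -/

section Lift

variable {m : ℕ} {M : Type u} [TopologicalSpace M] [T2Space M] [CompactSpace M]
  [ChartedSpace (𝔼 (m + 1)) M] [IsManifold (𝓡 (m + 1)) ∞ M]
  {f : M → ℝ} {ξ : Π x : M, TangentSpace (𝓡 (m + 1)) x} {a : ℝ}

/-- **The lift of `φ : Y → ℝ` along the trajectories**: `φ̄ z = φ (π z)` for the projection
`π = levelProj` onto the level `Y = f⁻¹(a)` (meaningful on `{Hits a}`; `0` elsewhere).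
[cite: MilnorHCobordism1965, proof of Thm. 5.4, Assertion 4 (PDF p. 29)] -/
def flowLift (hξ : ContMDiff (𝓡 (m + 1)) (𝓡 (m + 1)).tangent ∞ fun x => (⟨x, ξ x⟩ : TangentBundle (𝓡 (m + 1)) M))
    (h : IsRegularLevel (𝓡 (m + 1)) f a) (φ : RegularLevel h → ℝ) (z : M) : ℝ :=
  if hz : f (levelProj hξ f a z) = a then φ ⟨levelProj hξ f a z, hz⟩ else 0

variable {hξ : ContMDiff (𝓡 (m + 1)) (𝓡 (m + 1)).tangent ∞ fun x => (⟨x, ξ x⟩ : TangentBundle (𝓡 (m + 1)) M)}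
  {h : IsRegularLevel (𝓡 (m + 1)) f a}

/-- On `{Hits a}`, `φ̄ z = φ (π z)`. [folklore] -/
theorem flowLift_of_hits (φ : RegularLevel h → ℝ) {z : M} (hz : Hits (flowθ hξ) f a z) :
    flowLift hξ h φ z = φ ⟨levelProj hξ f a z, apply_levelProj hξ hz⟩ := by
  rw [flowLift, dif_pos (apply_levelProj hξ hz)]

omit [T2Space M] [CompactSpace M] [IsManifold (𝓡 (m + 1)) ∞ M] in
/-- The regular level has no critical points of `f` (in the form the flow lemmas ask for). [folklore] -/
theorem IsRegularLevel.forall_not_isMCriticalPt (h : IsRegularLevel (𝓡 (m + 1)) f a) :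
    ∀ x, f x = a → ¬ IsMCriticalPt (𝓡 (m + 1)) f x := fun _ hx => h.not_isMCriticalPt hx

/-- **`φ̄` restricts to `φ` on the level.** [folklore] -/
theorem flowLift_apply (hgl : IsGradientLike (𝓡 (m + 1)) f ξ) (hfM : IsMorse (𝓡 (m + 1)) f)
    (φ : RegularLevel h → ℝ) (y : RegularLevel h) : flowLift hξ h φ y.1 = φ y := by
  have hy : f y.1 = a := y.2
  have hhit : Hits (flowθ hξ) f a y.1 := hits_of_apply_eq (flow_zero hξ y.1) hy
  rw [flowLift_of_hits φ hhit]
  congr 1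
  exact Subtype.ext (hgl.levelProj_of_apply_eq hfM hξ h.forall_not_isMCriticalPt hy)

/-- `φ̄ ∘ incl = φ`. [folklore] -/
theorem flowLift_comp_incl (hgl : IsGradientLike (𝓡 (m + 1)) f ξ) (hfM : IsMorse (𝓡 (m + 1)) f)
    (φ : RegularLevel h → ℝ) : flowLift hξ h φ ∘ RegularLevel.incl h = φ :=
  funext fun y => flowLift_apply hgl hfM φ y

/-- **`φ̄` is constant along the trajectories.** [cite: MilnorHCobordism1965, Thm. 4.1 (PDF p. 22)] -/
theorem flowLift_flow (hgl : IsGradientLike (𝓡 (m + 1)) f ξ) (hfM : IsMorse (𝓡 (m + 1)) f)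
    (φ : RegularLevel h → ℝ) {z : M} (hz : Hits (flowθ hξ) f a z) (t : ℝ) :
    flowLift hξ h φ (flow hξ z t) = flowLift hξ h φ z := by
  have hz' : Hits (flowθ hξ) f a (flow hξ z t) := (isSmoothFlow_flow hξ).hits_apply_iff.2 hz
  rw [flowLift_of_hits φ hz', flowLift_of_hits φ hz]
  congr 1
  exact Subtype.ext (hgl.levelProj_flow hfM hξ h.forall_not_isMCriticalPt hz t)

/-- Near a point of `{Hits a}`, `φ̄ = φ̄ ∘ flow_t`. [folklore] -/
theorem flowLift_eventuallyEq_comp_flow (hgl : IsGradientLike (𝓡 (m + 1)) f ξ)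
    (hfM : IsMorse (𝓡 (m + 1)) f) (φ : RegularLevel h → ℝ) {z : M} (hz : Hits (flowθ hξ) f a z)
    (t : ℝ) : flowLift hξ h φ =ᶠ[𝓝 z] fun w => flowLift hξ h φ (flow hξ w t) := by
  filter_upwards [(hgl.isOpen_setOf_hits hfM hξ h.forall_not_isMCriticalPt).mem_nhds hz] with w hw
  exact (flowLift_flow hgl hfM φ hw t).symm

/-- **`φ̄` is smooth on `{Hits a}`** when `φ` is smooth. [cite: MilnorHCobordism1965, proof of Thm. 5.4, Assertion 4 (PDF p. 29)] -/
theorem contMDiffAt_flowLift (hgl : IsGradientLike (𝓡 (m + 1)) f ξ) (hfM : IsMorse (𝓡 (m + 1)) f)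
    {φ : RegularLevel h → ℝ} (hφ : ContMDiff (𝓡 m) 𝓘(ℝ, ℝ) ∞ φ) {z : M} (hz : Hits (flowθ hξ) f a z) :
    ContMDiffAt (𝓡 (m + 1)) 𝓘(ℝ, ℝ) ∞ (flowLift hξ h φ) z := by
  set U : Set M := {w | Hits (flowθ hξ) f a w} with hU
  have hUo : IsOpen U := hgl.isOpen_setOf_hits hfM hξ h.forall_not_isMCriticalPt
  have hπ : ContMDiffAt (𝓡 (m + 1)) (𝓡 (m + 1)) ∞ (levelProj hξ f a) z :=
    hgl.contMDiffAt_levelProj hfM hξ h.forall_not_isMCriticalPt hz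
  -- a global modification of `π` with values in `Y`
  classical
  set y₀ : M := levelProj hξ f a z with hy₀
  have hy₀a : f y₀ = a := apply_levelProj hξ hz
  let g : M → M := fun w => if Hits (flowθ hξ) f a w then levelProj hξ f a w else y₀
  have hgS : ∀ w, g w ∈ f ⁻¹' {a} := by
    intro w
    by_cases hw : Hits (flowθ hξ) f a w
    · simp only [g, hw, if_true]; exact apply_levelProj hξ hw
    · simp only [g, hw, if_false]; exact hy₀a
  have hgev : g =ᶠ[𝓝 z] levelProj hξ f a := by
    filter_upwards [hUo.mem_nhds hz] with w hw
    simp only [g, show Hits (flowθ hξ) f a w from hw, if_true]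
  have hg : ContMDiffAt (𝓡 (m + 1)) (𝓡 (m + 1)) ∞ g z := hπ.congr_of_eventuallyEq hgev
  set F : M → RegularLevel h := fun w => ⟨g w, hgS w⟩ with hFdef
  have hF : ContMDiffAt (𝓡 (m + 1)) (𝓡 m) ∞ F z := h.sliceChartFamily.contMDiffAt_mk hg hgS
  have hcomp : ContMDiffAt (𝓡 (m + 1)) 𝓘(ℝ, ℝ) ∞ (φ ∘ F) z := hφ.contMDiffAt.comp z hF
  refine hcomp.congr_of_eventuallyEq ?_
  filter_upwards [hUo.mem_nhds hz] with w hw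
  rw [flowLift_of_hits φ hw, comp_apply]
  congr 1
  apply Subtype.ext
  show levelProj hξ f a w = g w
  simp only [g, show Hits (flowθ hξ) f a w from hw, if_true]

/-! ### Derivatives along the flow -/

/-- A hitting point is not a critical point of `f` (its trajectory would be constant, on the
regular level). [folklore] -/
theorem not_isMCriticalPt_of_hits (hreg : IsRegularLevel (𝓡 (m + 1)) f a)
    (hgl : IsGradientLike (𝓡 (m + 1)) f ξ) {z : M} (hz : Hits (flowθ hξ) f a z) :
    ¬ IsMCriticalPt (𝓡 (m + 1)) f z := by
  intro hc
  obtain ⟨t, ht⟩ := hz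
  have h0 : ξ z = 0 := hgl.apply_eq_zero_of_isMCriticalPt hc
  have hconst : flow hξ z t = z := flow_eq_self_of_apply_eq_zero hξ h0 t
  have hza : f z = a := by
    have : f (flow hξ z t) = a := ht
    rwa [hconst] at this
  exact hreg.not_isMCriticalPt hza hc

/-- `ξ(f) > 0` at a hitting point. [cite: MilnorHCobordism1965, Def. 3.1] -/
theorem mlineDeriv_pos_of_hits (hreg : IsRegularLevel (𝓡 (m + 1)) f a)
    (hgl : IsGradientLike (𝓡 (m + 1)) f ξ) {z : M} (hz : Hits (flowθ hξ) f a z) :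
    0 < mlineDeriv (𝓡 (m + 1)) f z (ξ z) :=
  hgl.mlineDeriv_pos z (not_isMCriticalPt_of_hits hreg hgl hz)

/-- **`dφ̄(ξ) = 0`**: the lift is constant along the flow, so its derivative along the field
vanishes at every hitting point. [cite: MilnorHCobordism1965, Thm. 4.1 (PDF p. 22)] -/
theorem mlineDeriv_flowLift_eq_zero (hgl : IsGradientLike (𝓡 (m + 1)) f ξ) (hfM : IsMorse (𝓡 (m + 1)) f)
    {φ : RegularLevel h → ℝ} (hφ : ContMDiff (𝓡 m) 𝓘(ℝ, ℝ) ∞ φ) {z : M} (hz : Hits (flowθ hξ) f a z) :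
    mlineDeriv (𝓡 (m + 1)) (flowLift hξ h φ) z (ξ z) = 0 := by
  have hd : MDifferentiableAt (𝓡 (m + 1)) 𝓘(ℝ, ℝ) (flowLift hξ h φ) (flow hξ z 0) := by
    rw [flow_zero]
    exact (contMDiffAt_flowLift hgl hfM hφ hz).mdifferentiableAt (by simp)
  have h1 : HasDerivWithinAt (flowLift hξ h φ ∘ flow hξ z)
      (mlineDeriv (𝓡 (m + 1)) (flowLift hξ h φ) (flow hξ z 0) (ξ (flow hξ z 0))) univ 0 :=
    ((isMIntegralCurve_flow hξ z).isMIntegralCurveOn univ).hasDerivWithinAt_comp (mem_univ 0) hd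
  have h2 : HasDerivAt (flowLift hξ h φ ∘ flow hξ z) 0 0 := by
    have hfun : flowLift hξ h φ ∘ flow hξ z = fun _ => flowLift hξ h φ z :=
      funext fun t => flowLift_flow hgl hfM φ hz t
    rw [hfun]
    exact hasDerivAt_const 0 _
  have h3 := (h1.hasDerivAt univ_mem).unique h2
  rwa [flow_zero] at h3

/-! ### The flow curve read in a chart -/

/-- **The chart image of a flow curve is differentiable**, with derivative the chart image of
the field: `d/dt ê(flow z t) = dê(ξ)` at times when the curve is in the chart domain (as in
`IsFlowOf.hasDerivAt_coord`). [cite: MilnorHCobordism1965, Def. 3.1] -/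
theorem hasDerivAt_extend_flow {e : OpenPartialHomeomorph M (𝔼 (m + 1))}
    (he : e ∈ IsManifold.maximalAtlas (𝓡 (m + 1)) ∞ M) {z : M} {s : ℝ} (hs : flow hξ z s ∈ e.source) :
    HasDerivAt (fun t => e.extend (𝓡 (m + 1)) (flow hξ z t))
      (mfderiv (𝓡 (m + 1)) 𝓘(ℝ, 𝔼 (m + 1)) (e.extend (𝓡 (m + 1))) (flow hξ z s) (ξ (flow hξ z s))) s := by
  have hγ : HasMFDerivAt 𝓘(ℝ, ℝ) (𝓡 (m + 1)) (fun t => flow hξ z t) s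
      ((1 : ℝ →L[ℝ] ℝ).smulRight (ξ (flow hξ z s))) := isMIntegralCurve_flow hξ z s
  have hφ : HasMFDerivAt (𝓡 (m + 1)) 𝓘(ℝ, 𝔼 (m + 1)) (e.extend (𝓡 (m + 1))) (flow hξ z s)
      (mfderiv (𝓡 (m + 1)) 𝓘(ℝ, 𝔼 (m + 1)) (e.extend (𝓡 (m + 1))) (flow hξ z s)) :=
    (mdifferentiableAt_extend_of_mem_maximalAtlas he hs).hasMFDerivAt
  have h1 := hφ.comp s hγ
  have h2 : HasFDerivAt (e.extend (𝓡 (m + 1)) ∘ fun t => flow hξ z t)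
      ((mfderiv (𝓡 (m + 1)) 𝓘(ℝ, 𝔼 (m + 1)) (e.extend (𝓡 (m + 1))) (flow hξ z s)).comp
        ((1 : ℝ →L[ℝ] ℝ).smulRight (ξ (flow hξ z s)))) s :=
    hasMFDerivAt_iff_hasFDerivAt.1 h1
  have h3 : ((mfderiv (𝓡 (m + 1)) 𝓘(ℝ, 𝔼 (m + 1)) (e.extend (𝓡 (m + 1))) (flow hξ z s)).comp
        ((1 : ℝ →L[ℝ] ℝ).smulRight (ξ (flow hξ z s))) : ℝ →L[ℝ] 𝔼 (m + 1)) =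
      (1 : ℝ →L[ℝ] ℝ).smulRight
        (mfderiv (𝓡 (m + 1)) 𝓘(ℝ, 𝔼 (m + 1)) (e.extend (𝓡 (m + 1))) (flow hξ z s) (ξ (flow hξ z s))) := by
    apply ContinuousLinearMap.ext_ring
    simp only [ContinuousLinearMap.comp_apply, ContinuousLinearMap.smulRight_apply]
    rw [map_smul]
  exact hasDerivAt_iff_hasFDerivAt.2 (h2.congr_fderiv h3)

/-- **Chart derivatives along the field from derivatives along the flow**: for a function `G`
differentiable in the chart `e` at `e z`, the derivative of `G ∘ e⁻¹` at `e z` on the chart image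
`ξ̂ = dê(ξ z)` of the field is the derivative of `t ↦ G(flow z t)` at `0`. [cite: MilnorHCobordism1965, Def. 3.1] -/
theorem fderiv_comp_symm_apply_eq_of_hasDerivAt {e : OpenPartialHomeomorph M (𝔼 (m + 1))}
    (he : e ∈ IsManifold.maximalAtlas (𝓡 (m + 1)) ∞ M) {z : M} (hze : z ∈ e.source) {G : M → ℝ}
    (hG : DifferentiableAt ℝ (G ∘ e.symm) (e z)) {d : ℝ} (hd : HasDerivAt (G ∘ flow hξ z) d 0) :
    fderiv ℝ (G ∘ e.symm) (e z)
      (mfderiv (𝓡 (m + 1)) 𝓘(ℝ, 𝔼 (m + 1)) (e.extend (𝓡 (m + 1))) z (ξ z)) = d := by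
  set v : 𝔼 (m + 1) := mfderiv (𝓡 (m + 1)) 𝓘(ℝ, 𝔼 (m + 1)) (e.extend (𝓡 (m + 1))) z (ξ z) with hv
  have hcurve : HasDerivAt (fun t => e.extend (𝓡 (m + 1)) (flow hξ z t)) v 0 := by
    have h0 : flow hξ z 0 ∈ e.source := by rw [flow_zero]; exact hze
    have := hasDerivAt_extend_flow (hξ := hξ) he h0
    rw [flow_zero] at this
    exact this
  have hev : ∀ᶠ t in 𝓝 (0 : ℝ), flow hξ z t ∈ e.source := by
    have hc : Continuous fun t => flow hξ z t := continuous_flow hξ z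
    have : flow hξ z 0 ∈ e.source := by rw [flow_zero]; exact hze
    exact hc.continuousAt.preimage_mem_nhds (e.open_source.mem_nhds this)
  have hext : ∀ w, e.extend (𝓡 (m + 1)) w = e w := fun w => by simp
  have hcurve' : HasDerivAt (fun t => e (flow hξ z t)) v 0 := by
    simpa only [hext] using hcurve
  have hz0 : e (flow hξ z 0) = e z := by rw [flow_zero]
  have h1 : HasDerivAt (fun t => (G ∘ e.symm) (e (flow hξ z t))) (fderiv ℝ (G ∘ e.symm) (e z) v) 0 := by
    have h := hG.hasFDerivAt
    rw [← hz0] at h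
    have := h.comp_hasDerivAt (0 : ℝ) hcurve'
    rwa [hz0] at this
  have h2 : HasDerivAt (fun t => (G ∘ e.symm) (e (flow hξ z t))) d 0 := by
    have heq : (fun t => (G ∘ e.symm) (e (flow hξ z t))) =ᶠ[𝓝 0] G ∘ flow hξ z := by
      filter_upwards [hev] with t ht
      rw [comp_apply, e.left_inv ht, comp_apply]
    exact hd.congr_of_eventuallyEq heq
  exact h1.unique h2

omit [T2Space M] [CompactSpace M] [IsManifold (𝓡 (m + 1)) ∞ M] in
/-- `f ∘ e⁻¹` is differentiable at the chart image of any point (Morse `f`). [folklore] -/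
theorem differentiableAt_comp_symm_of_isMorse (hfM : IsMorse (𝓡 (m + 1)) f)
    {e : OpenPartialHomeomorph M (𝔼 (m + 1))} (he : e ∈ IsManifold.maximalAtlas (𝓡 (m + 1)) ∞ M)
    {z : M} (hze : z ∈ e.source) : DifferentiableAt ℝ (f ∘ e.symm) (e z) := by
  have he2 : e ∈ IsManifold.maximalAtlas (𝓡 (m + 1)) 2 M :=
    IsManifold.maximalAtlas_subset_of_le (by norm_cast) he
  have := contDiffAt_comp_extend_symm ((hfM.contMDiff z).of_le (by norm_cast)) he2 hze
  simp only [OpenPartialHomeomorph.extend_coe, OpenPartialHomeomorph.extend_coe_symm,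
    modelWithCornersSelf_coe, modelWithCornersSelf_coe_symm, CompTriple.comp_eq] at this
  exact this.differentiableAt (by norm_num)

/-- `φ̄ ∘ e⁻¹` is `C²` at the chart image of a hitting point. [folklore] -/
theorem contDiffAt_flowLift_comp_symm (hgl : IsGradientLike (𝓡 (m + 1)) f ξ) (hfM : IsMorse (𝓡 (m + 1)) f)
    {φ : RegularLevel h → ℝ} (hφ : ContMDiff (𝓡 m) 𝓘(ℝ, ℝ) ∞ φ) {e : OpenPartialHomeomorph M (𝔼 (m + 1))}
    (he : e ∈ IsManifold.maximalAtlas (𝓡 (m + 1)) ∞ M) {z : M} (hze : z ∈ e.source)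
    (hz : Hits (flowθ hξ) f a z) : ContDiffAt ℝ 2 (flowLift hξ h φ ∘ e.symm) (e z) := by
  have he2 : e ∈ IsManifold.maximalAtlas (𝓡 (m + 1)) 2 M :=
    IsManifold.maximalAtlas_subset_of_le (by norm_cast) he
  have hF2 : ContMDiffAt (𝓡 (m + 1)) 𝓘(ℝ, ℝ) 2 (flowLift hξ h φ) z :=
    (contMDiffAt_flowLift hgl hfM hφ hz).of_le (by norm_cast)
  have := contDiffAt_comp_extend_symm hF2 he2 hze
  simp only [OpenPartialHomeomorph.extend_coe, OpenPartialHomeomorph.extend_coe_symm,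
    modelWithCornersSelf_coe, modelWithCornersSelf_coe_symm, CompTriple.comp_eq] at this
  exact this

/-- **`ξ̂` is a kernel vector of `D(φ̄ ∘ e⁻¹)`.** [cite: MilnorHCobordism1965, Thm. 4.1] -/
theorem fderiv_flowLift_comp_symm_apply_eq_zero (hgl : IsGradientLike (𝓡 (m + 1)) f ξ)
    (hfM : IsMorse (𝓡 (m + 1)) f) {φ : RegularLevel h → ℝ} (hφ : ContMDiff (𝓡 m) 𝓘(ℝ, ℝ) ∞ φ)
    {e : OpenPartialHomeomorph M (𝔼 (m + 1))} (he : e ∈ IsManifold.maximalAtlas (𝓡 (m + 1)) ∞ M)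
    {z : M} (hze : z ∈ e.source) (hz : Hits (flowθ hξ) f a z) :
    fderiv ℝ (flowLift hξ h φ ∘ e.symm) (e z)
      (mfderiv (𝓡 (m + 1)) 𝓘(ℝ, 𝔼 (m + 1)) (e.extend (𝓡 (m + 1))) z (ξ z)) = 0 := by
  refine fderiv_comp_symm_apply_eq_of_hasDerivAt (hξ := hξ) he hze
    ((contDiffAt_flowLift_comp_symm hgl hfM hφ he hze hz).differentiableAt (by norm_num)) ?_
  have hfun : flowLift hξ h φ ∘ flow hξ z = fun _ => flowLift hξ h φ z :=
    funext fun t => flowLift_flow hgl hfM φ hz t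
  rw [hfun]
  exact hasDerivAt_const 0 _

include hξ in
/-- **`D(f ∘ e⁻¹)(ξ̂) = ξ(f) > 0`.** [cite: MilnorHCobordism1965, Def. 3.1] -/
theorem fderiv_comp_symm_apply_eq_mlineDeriv (hfM : IsMorse (𝓡 (m + 1)) f)
    {e : OpenPartialHomeomorph M (𝔼 (m + 1))} (he : e ∈ IsManifold.maximalAtlas (𝓡 (m + 1)) ∞ M)
    {z : M} (hze : z ∈ e.source) :
    fderiv ℝ (f ∘ e.symm) (e z) (mfderiv (𝓡 (m + 1)) 𝓘(ℝ, 𝔼 (m + 1)) (e.extend (𝓡 (m + 1))) z (ξ z)) =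
      mlineDeriv (𝓡 (m + 1)) f z (ξ z) := by
  refine fderiv_comp_symm_apply_eq_of_hasDerivAt (hξ := hξ) he hze
    (differentiableAt_comp_symm_of_isMorse hfM he hze) ?_
  have h := hasDerivAt_comp_flow hξ (hfM.contMDiff.mdifferentiable (by simp)) z 0
  rw [flow_zero] at h
  exact h

/-- **`D((f ∘ flow_{t₀}) ∘ e⁻¹)(ξ̂) = ξ(f)(flow z t₀) > 0`** (the time-shifted function is
still increasing along the flow). [cite: MilnorHCobordism1965, Def. 3.1] -/
theorem fderiv_comp_flow_comp_symm_apply_eq (hfM : IsMorse (𝓡 (m + 1)) f)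
    {e : OpenPartialHomeomorph M (𝔼 (m + 1))} (he : e ∈ IsManifold.maximalAtlas (𝓡 (m + 1)) ∞ M)
    {z : M} (hze : z ∈ e.source) (t₀ : ℝ)
    (hG : DifferentiableAt ℝ ((fun w => f (flow hξ w t₀)) ∘ e.symm) (e z)) :
    fderiv ℝ ((fun w => f (flow hξ w t₀)) ∘ e.symm) (e z)
      (mfderiv (𝓡 (m + 1)) 𝓘(ℝ, 𝔼 (m + 1)) (e.extend (𝓡 (m + 1))) z (ξ z)) =
      mlineDeriv (𝓡 (m + 1)) f (flow hξ z t₀) (ξ (flow hξ z t₀)) := by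
  refine fderiv_comp_symm_apply_eq_of_hasDerivAt (hξ := hξ) he hze hG ?_
  have hfun : (fun w => f (flow hξ w t₀)) ∘ flow hξ z = fun t => (f ∘ flow hξ z) (t + t₀) := by
    funext t
    simp only [comp_apply, ← flow_add]
  rw [hfun]
  have h := hasDerivAt_comp_flow hξ (hfM.contMDiff.mdifferentiable (by simp)) z (0 + t₀)
  have h' := h.comp_add_const 0 t₀
  rw [zero_add] at h'
  exact h'

/-- **The field read in a chart is a kernel vector of `D(φ̄ ∘ ê⁻¹)` and not of `D(f ∘ ê⁻¹)`**:
at a hitting point `z` of a chart `e` of the maximal atlas there is a vector `ξ̂` (the chart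
image of `ξ z`) with `D(φ̄ ∘ e⁻¹)(e z) ξ̂ = 0` and `D(f ∘ e⁻¹)(e z) ξ̂ > 0`.
[cite: MilnorHCobordism1965, Def. 3.1, Thm. 4.1] -/
theorem exists_fderiv_comp_symm_apply (hgl : IsGradientLike (𝓡 (m + 1)) f ξ) (hfM : IsMorse (𝓡 (m + 1)) f)
    {φ : RegularLevel h → ℝ} (hφ : ContMDiff (𝓡 m) 𝓘(ℝ, ℝ) ∞ φ) {e : OpenPartialHomeomorph M (𝔼 (m + 1))}
    (he : e ∈ IsManifold.maximalAtlas (𝓡 (m + 1)) ∞ M) {z : M} (hze : z ∈ e.source)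
    (hz : Hits (flowθ hξ) f a z) :
    ∃ v : 𝔼 (m + 1), fderiv ℝ (flowLift hξ h φ ∘ e.symm) (e z) v = 0 ∧
      0 < fderiv ℝ (f ∘ e.symm) (e z) v :=
  ⟨_, fderiv_flowLift_comp_symm_apply_eq_zero hgl hfM hφ he hze hz, by
    rw [fderiv_comp_symm_apply_eq_mlineDeriv (hξ := hξ) hfM he hze]
    exact mlineDeriv_pos_of_hits h hgl hz⟩

/-! ### Critical points of the lift -/

/-- **On the level, `φ̄` is critical exactly where `φ` is**: Lagrange's condition
(`RegularLevel.isMCriticalPt_comp_incl_iff_of_chart`) closed up by `dφ̄(ξ) = 0 < df(ξ)`.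
[cite: Milnor1963, §2] [cite: LeeSmoothManifolds2013, Prop. 5.38] -/
theorem isMCriticalPt_flowLift_iff_of_level (hgl : IsGradientLike (𝓡 (m + 1)) f ξ)
    (hfM : IsMorse (𝓡 (m + 1)) f) {φ : RegularLevel h → ℝ} (hφ : ContMDiff (𝓡 m) 𝓘(ℝ, ℝ) ∞ φ)
    (y : RegularLevel h) :
    IsMCriticalPt (𝓡 (m + 1)) (flowLift hξ h φ) y.1 ↔ IsMCriticalPt (𝓡 m) φ y := by
  have hy : Hits (flowθ hξ) f a y.1 := hits_of_apply_eq (flow_zero hξ y.1) y.2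
  set e := chartAt (𝔼 (m + 1)) y.1 with hedef
  have he : e ∈ IsManifold.maximalAtlas (𝓡 (m + 1)) ∞ M := IsManifold.chart_mem_maximalAtlas y.1
  have hye : y.1 ∈ e.source := mem_chart_source _ y.1
  have hF : ContMDiffAt (𝓡 (m + 1)) 𝓘(ℝ, ℝ) ∞ (flowLift hξ h φ) y.1 := contMDiffAt_flowLift hgl hfM hφ hy
  have hF2 : ContMDiffAt (𝓡 (m + 1)) 𝓘(ℝ, ℝ) 2 (flowLift hξ h φ) y.1 := hF.of_le (by norm_cast)
  have hlag := RegularLevel.isMCriticalPt_comp_incl_iff_of_chart y hF2 he hye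
  rw [flowLift_comp_incl hgl hfM φ] at hlag
  have hamb : IsMCriticalPt (𝓡 (m + 1)) (flowLift hξ h φ) y.1 ↔
      fderiv ℝ (flowLift hξ h φ ∘ e.symm) (e y.1) = 0 :=
    isMCriticalPt_iff_fderiv_comp_symm_eq_zero (contMDiffOn_of_mem_maximalAtlas he)
      (contMDiffOn_symm_of_mem_maximalAtlas he) hye (hF.mdifferentiableAt (by simp))
  rw [hamb, hlag]
  constructor
  · intro h0 v _
    rw [h0]; rfl
  · intro hker
    obtain ⟨v, hv0, hvpos⟩ := exists_fderiv_comp_symm_apply hgl hfM hφ he hye hy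
    exact TubeModel.clm_eq_zero_of_forall_apply_eq_zero hker hvpos.ne' hv0

/-- **Criticality of `φ̄` propagates along the trajectories.** [cite: MilnorHCobordism1965, Thm. 4.1 (PDF p. 22)] -/
theorem isMCriticalPt_flowLift_flow_iff (hgl : IsGradientLike (𝓡 (m + 1)) f ξ)
    (hfM : IsMorse (𝓡 (m + 1)) f) {φ : RegularLevel h → ℝ} (hφ : ContMDiff (𝓡 m) 𝓘(ℝ, ℝ) ∞ φ)
    {z : M} (hz : Hits (flowθ hξ) f a z) (t : ℝ) :
    IsMCriticalPt (𝓡 (m + 1)) (flowLift hξ h φ) (flow hξ z t) ↔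
      IsMCriticalPt (𝓡 (m + 1)) (flowLift hξ h φ) z := by
  -- one direction, for all hitting points and times
  have key : ∀ {w : M} (hw : Hits (flowθ hξ) f a w) (s : ℝ),
      IsMCriticalPt (𝓡 (m + 1)) (flowLift hξ h φ) w →
        IsMCriticalPt (𝓡 (m + 1)) (flowLift hξ h φ) (flow hξ w s) := by
    intro w hw s hc
    have hws : Hits (flowθ hξ) f a (flow hξ w s) := (isSmoothFlow_flow hξ).hits_apply_iff.2 hw
    -- `φ̄ = φ̄ ∘ flow_{-s}` near `flow w s`, and `flow_{-s} (flow w s) = w`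
    have hev := flowLift_eventuallyEq_comp_flow hgl hfM φ hws (-s)
    have hd : MDifferentiableAt (𝓡 (m + 1)) 𝓘(ℝ, ℝ) (flowLift hξ h φ) (flow hξ (flow hξ w s) (-s)) := by
      rw [flow_neg_flow]
      exact (contMDiffAt_flowLift hgl hfM hφ hw).mdifferentiableAt (by simp)
    have hfl : MDifferentiableAt (𝓡 (m + 1)) (𝓡 (m + 1)) (fun x => flow hξ x (-s)) (flow hξ w s) :=
      (contMDiff_flow_apply hξ (-s)).mdifferentiableAt (by simp)
    unfold IsMCriticalPt at hc ⊢
    rw [hev.mfderiv_eq]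
    have hcomp := mfderiv_comp (flow hξ w s) hd hfl
    rw [show (fun x => flowLift hξ h φ (flow hξ x (-s))) = flowLift hξ h φ ∘ fun x => flow hξ x (-s) from rfl,
      hcomp]
    rw [flow_neg_flow, hc, ContinuousLinearMap.zero_comp]
    rfl
  constructor
  · intro hc
    have hzt : Hits (flowθ hξ) f a (flow hξ z t) := (isSmoothFlow_flow hξ).hits_apply_iff.2 hz
    have := key hzt (-t) hc
    rwa [flow_neg_flow] at this
  · exact key hz t

/-- **`z` is critical for `φ̄` iff `π z` is critical for `φ`.** [cite: MilnorHCobordism1965, Thm. 4.1 (PDF p. 22)] -/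
theorem isMCriticalPt_flowLift_iff (hgl : IsGradientLike (𝓡 (m + 1)) f ξ) (hfM : IsMorse (𝓡 (m + 1)) f)
    {φ : RegularLevel h → ℝ} (hφ : ContMDiff (𝓡 m) 𝓘(ℝ, ℝ) ∞ φ) {z : M} (hz : Hits (flowθ hξ) f a z) :
    IsMCriticalPt (𝓡 (m + 1)) (flowLift hξ h φ) z ↔
      IsMCriticalPt (𝓡 m) φ ⟨levelProj hξ f a z, apply_levelProj hξ hz⟩ := by
  set y : RegularLevel h := ⟨levelProj hξ f a z, apply_levelProj hξ hz⟩ with hy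
  have hyhit : Hits (flowθ hξ) f a y.1 := hits_of_apply_eq (flow_zero hξ y.1) y.2
  obtain ⟨t, ht⟩ := mem_range_flow_levelProj hξ a z
  have ht' : flow hξ y.1 t = z := ht
  rw [← isMCriticalPt_flowLift_iff_of_level hgl hfM hφ y, ← ht',
    isMCriticalPt_flowLift_flow_iff hgl hfM hφ hyhit t]

/-! ### Critical points of `Γ(φ̄, f)` -/

/-- `DΓ_p (s, t) = s · DΓ_p (1, 0) + t · DΓ_p (0, 1)`. [folklore] -/
theorem fderiv_prod_apply' (Γ : ℝ × ℝ → ℝ) (p : ℝ × ℝ) (s t : ℝ) :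
    fderiv ℝ Γ p (s, t) = s * fderiv ℝ Γ p (1, 0) + t * fderiv ℝ Γ p (0, 1) := by
  have h : ((s, t) : ℝ × ℝ) = s • ((1 : ℝ), (0 : ℝ)) + t • ((0 : ℝ), (1 : ℝ)) := by
    ext <;> simp
  rw [h, map_add, map_smul, map_smul, smul_eq_mul, smul_eq_mul]

/-- `Γ(φ̄, f)` is smooth at hitting points (`Γ` of class `C^n` at the value pair). [folklore] -/
theorem contMDiffAt_comp₂ (hgl : IsGradientLike (𝓡 (m + 1)) f ξ) (hfM : IsMorse (𝓡 (m + 1)) f)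
    {φ : RegularLevel h → ℝ} (hφ : ContMDiff (𝓡 m) 𝓘(ℝ, ℝ) ∞ φ) {Γ : ℝ × ℝ → ℝ} {n : WithTop ℕ∞}
    (hn : n ≤ ∞) {z : M} (hz : Hits (flowθ hξ) f a z) (hΓ : ContDiffAt ℝ n Γ (flowLift hξ h φ z, f z)) :
    ContMDiffAt (𝓡 (m + 1)) 𝓘(ℝ, ℝ) n (fun w => Γ (flowLift hξ h φ w, f w)) z := by
  have h1 : ContMDiffAt (𝓡 (m + 1)) 𝓘(ℝ, ℝ × ℝ) n (fun w => (flowLift hξ h φ w, f w)) z :=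
    ((contMDiffAt_flowLift hgl hfM hφ hz).of_le hn).prodMk_space ((hfM.contMDiff z).of_le hn)
  exact hΓ.contMDiffAt.comp z h1

/-- **Critical points of `Ψ = Γ(φ̄, f)` ("flow rule", first order)**: at a hitting point `z`,
`Ψ` is critical iff `∂₂Γ(φ̄ z, f z) = 0` and (`∂₁Γ(φ̄ z, f z) = 0` or `π z` is a critical point
of `φ`) — since `dΨ = ∂₁Γ dφ̄ + ∂₂Γ df` with `dφ̄(ξ) = 0 < df(ξ)`.  In the construction of the
sectors this locates the critical points of the sector functions on the fibres over the
critical points of the Heegaard function. [cite: Milnor1963, §3] [cite: GayKirby2016, §4, Lemma 14] -/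
theorem isMCriticalPt_comp₂_iff (hgl : IsGradientLike (𝓡 (m + 1)) f ξ) (hfM : IsMorse (𝓡 (m + 1)) f)
    {φ : RegularLevel h → ℝ} (hφ : ContMDiff (𝓡 m) 𝓘(ℝ, ℝ) ∞ φ) {Γ : ℝ × ℝ → ℝ}
    {z : M} (hz : Hits (flowθ hξ) f a z) (hΓ : ContDiffAt ℝ 1 Γ (flowLift hξ h φ z, f z)) :
    IsMCriticalPt (𝓡 (m + 1)) (fun w => Γ (flowLift hξ h φ w, f w)) z ↔
      fderiv ℝ Γ (flowLift hξ h φ z, f z) (0, 1) = 0 ∧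
        (fderiv ℝ Γ (flowLift hξ h φ z, f z) (1, 0) = 0 ∨
          IsMCriticalPt (𝓡 m) φ ⟨levelProj hξ f a z, apply_levelProj hξ hz⟩) := by
  set F := flowLift hξ h φ with hFdef
  set e := chartAt (𝔼 (m + 1)) z with hedef
  have he : e ∈ IsManifold.maximalAtlas (𝓡 (m + 1)) ∞ M := IsManifold.chart_mem_maximalAtlas z
  have he2 : e ∈ IsManifold.maximalAtlas (𝓡 (m + 1)) 2 M :=
    IsManifold.maximalAtlas_subset_of_le (by norm_cast) he
  have hze : z ∈ e.source := mem_chart_source _ z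
  have hFc : ContMDiffAt (𝓡 (m + 1)) 𝓘(ℝ, ℝ) ∞ F z := contMDiffAt_flowLift hgl hfM hφ hz
  have hΨc : ContMDiffAt (𝓡 (m + 1)) 𝓘(ℝ, ℝ) 1 (fun w => Γ (F w, f w)) z :=
    contMDiffAt_comp₂ hgl hfM hφ (by norm_cast) hz hΓ
  -- differentiability of the written functions
  have hFd : DifferentiableAt ℝ (F ∘ e.symm) (e z) := by
    have := contDiffAt_comp_extend_symm (hFc.of_le (by norm_cast)) he2 hze
    simp only [OpenPartialHomeomorph.extend_coe, OpenPartialHomeomorph.extend_coe_symm,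
      modelWithCornersSelf_coe, modelWithCornersSelf_coe_symm, CompTriple.comp_eq] at this
    exact this.differentiableAt (by norm_num)
  have hfd : DifferentiableAt ℝ (f ∘ e.symm) (e z) := by
    have := contDiffAt_comp_extend_symm ((hfM.contMDiff z).of_le (by norm_cast)) he2 hze
    simp only [OpenPartialHomeomorph.extend_coe, OpenPartialHomeomorph.extend_coe_symm,
      modelWithCornersSelf_coe, modelWithCornersSelf_coe_symm, CompTriple.comp_eq] at this
    exact this.differentiableAt (by norm_num)
  have hΓd : DifferentiableAt ℝ Γ ((F ∘ e.symm) (e z), (f ∘ e.symm) (e z)) := by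
    simp only [comp_apply, e.left_inv hze]
    exact hΓ.differentiableAt one_ne_zero
  -- criticality in the chart
  have hcritΨ : IsMCriticalPt (𝓡 (m + 1)) (fun w => Γ (F w, f w)) z ↔
      fderiv ℝ ((fun w => Γ (F w, f w)) ∘ e.symm) (e z) = 0 :=
    isMCriticalPt_iff_fderiv_comp_symm_eq_zero (contMDiffOn_of_mem_maximalAtlas he)
      (contMDiffOn_symm_of_mem_maximalAtlas he) hze (hΨc.mdifferentiableAt one_ne_zero)
  have hcritF : IsMCriticalPt (𝓡 (m + 1)) F z ↔ fderiv ℝ (F ∘ e.symm) (e z) = 0 :=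
    isMCriticalPt_iff_fderiv_comp_symm_eq_zero (contMDiffOn_of_mem_maximalAtlas he)
      (contMDiffOn_symm_of_mem_maximalAtlas he) hze (hFc.mdifferentiableAt (by simp))
  -- the chain rule
  have hchain : ∀ v, fderiv ℝ ((fun w => Γ (F w, f w)) ∘ e.symm) (e z) v =
      fderiv ℝ (F ∘ e.symm) (e z) v * fderiv ℝ Γ (F z, f z) (1, 0) +
        fderiv ℝ (f ∘ e.symm) (e z) v * fderiv ℝ Γ (F z, f z) (0, 1) := by
    intro v
    have hfun : (fun w => Γ (F w, f w)) ∘ e.symm =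
        fun u => Γ ((F ∘ e.symm) u, (f ∘ e.symm) u) := rfl
    have hτ : DifferentiableAt ℝ (fun u => ((F ∘ e.symm) u, (f ∘ e.symm) u)) (e z) := hFd.prodMk hfd
    rw [hfun, show (fun u => Γ ((F ∘ e.symm) u, (f ∘ e.symm) u)) =
        Γ ∘ fun u => ((F ∘ e.symm) u, (f ∘ e.symm) u) from rfl,
      fderiv_comp (e z) hΓd hτ, ContinuousLinearMap.comp_apply, hFd.fderiv_prodMk hfd]
    simp only [ContinuousLinearMap.prod_apply, comp_apply, e.left_inv hze]
    rw [fderiv_prod_apply']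
  obtain ⟨v₀, hv₀, hv₀pos⟩ := exists_fderiv_comp_symm_apply hgl hfM hφ he hze hz
  rw [hcritΨ, isMCriticalPt_flowLift_iff hgl hfM hφ hz |>.symm, hcritF]
  constructor
  · intro h0
    have hv : ∀ v, fderiv ℝ (F ∘ e.symm) (e z) v * fderiv ℝ Γ (F z, f z) (1, 0) +
        fderiv ℝ (f ∘ e.symm) (e z) v * fderiv ℝ Γ (F z, f z) (0, 1) = 0 := fun v => by
      rw [← hchain v, h0]; rfl
    have h2 : fderiv ℝ Γ (F z, f z) (0, 1) = 0 := by
      have := hv v₀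
      rw [hv₀, zero_mul, zero_add] at this
      exact (mul_eq_zero.1 this).resolve_left hv₀pos.ne'
    refine ⟨h2, ?_⟩
    by_cases h1 : fderiv ℝ Γ (F z, f z) (1, 0) = 0
    · exact Or.inl h1
    · right
      ext v
      have := hv v
      rw [h2, mul_zero, add_zero] at this
      exact (mul_eq_zero.1 this).resolve_right h1
  · rintro ⟨h2, h1⟩
    ext v
    rw [hchain v, h2, mul_zero, add_zero]
    rcases h1 with h1 | h1
    · rw [h1, mul_zero]; rfl
    · rw [show fderiv ℝ (F ∘ e.symm) (e z) v = 0 by rw [h1]; rfl, zero_mul]; rfl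

/-- **Regularity off the critical fibres**: if `∂₂Γ ≠ 0` at the value pair, `Γ(φ̄, f)` is
regular at `z`. [cite: GayKirby2016, §4, Lemma 14] -/
theorem not_isMCriticalPt_comp₂_of_snd (hgl : IsGradientLike (𝓡 (m + 1)) f ξ) (hfM : IsMorse (𝓡 (m + 1)) f)
    {φ : RegularLevel h → ℝ} (hφ : ContMDiff (𝓡 m) 𝓘(ℝ, ℝ) ∞ φ) {Γ : ℝ × ℝ → ℝ}
    {z : M} (hz : Hits (flowθ hξ) f a z) (hΓ : ContDiffAt ℝ 1 Γ (flowLift hξ h φ z, f z))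
    (h2 : fderiv ℝ Γ (flowLift hξ h φ z, f z) (0, 1) ≠ 0) :
    ¬ IsMCriticalPt (𝓡 (m + 1)) (fun w => Γ (flowLift hξ h φ w, f w)) z := fun hc =>
  h2 ((isMCriticalPt_comp₂_iff hgl hfM hφ hz hΓ).1 hc).1

/-- **Regularity over regular points of `φ`**: if `∂₁Γ ≠ 0` at the value pair and `π z` is a
regular point of `φ`, then `Γ(φ̄, f)` is regular at `z`. [cite: GayKirby2016, §4, Lemma 14] -/
theorem not_isMCriticalPt_comp₂_of_fst (hgl : IsGradientLike (𝓡 (m + 1)) f ξ) (hfM : IsMorse (𝓡 (m + 1)) f)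
    {φ : RegularLevel h → ℝ} (hφ : ContMDiff (𝓡 m) 𝓘(ℝ, ℝ) ∞ φ) {Γ : ℝ × ℝ → ℝ}
    {z : M} (hz : Hits (flowθ hξ) f a z) (hΓ : ContDiffAt ℝ 1 Γ (flowLift hξ h φ z, f z))
    (h1 : fderiv ℝ Γ (flowLift hξ h φ z, f z) (1, 0) ≠ 0)
    (hreg : ¬ IsMCriticalPt (𝓡 m) φ ⟨levelProj hξ f a z, apply_levelProj hξ hz⟩) :
    ¬ IsMCriticalPt (𝓡 (m + 1)) (fun w => Γ (flowLift hξ h φ w, f w)) z := fun hc => by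
  rcases ((isMCriticalPt_comp₂_iff hgl hfM hφ hz hΓ).1 hc).2 with h | h
  · exact h1 h
  · exact hreg h

end Lift

end Literature.Topology.FourManifolds

end
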